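import Summits.HodgeConjecture.HodgeConjecture.Theorems.HodgeLocusCensusPlaneSumRank4
import Summits.HodgeConjecture.HodgeConjecture.Theorems.HodgeLocusCensusPlaneSumCertsA
import Summits.HodgeConjecture.HodgeConjecture.Theorems.HodgeLocusCensusPlaneSumCertsB
import Summits.HodgeConjecture.HodgeConjecture.Theorems.HodgeLocusCensusPlaneSumCertsC
import HarnessLib

/-!
# HodgeLocusCensusPlaneSumCells4 — PROVED: the six plane-sum census rows of the Fermat quartic FOURFOLD (ranks 12, 13, 11, 11, 16, 16) (cell pub-hlocus, LEAD gen 5, (T36))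
HONEST FRAMING: certified instances and evidence bearing on the general Hodge conjecture; no claim.

Corollaries of `ivhsRankEq_of_cert4` (`HodgeLocusCensusPlaneSumRank4`) and the kernel-checked certificates (`HodgeLocusCensusPlaneSumCertsA/B/C`):
the typed rows `explainedSmooth_4_4_scroll` ([Z] − [Π], rank 12), `firstOrder_4_4_zPlusPi` ([Z] + [Π], 13), the twist cells [Z] ∓ [Z′] (11, 11) of
`HodgeLocusCensusTwistCells` and `explainedSmooth_4_4_ZplusPiPrime` / `notAlpha_4_4_ZminusPiPrime` ([Z] ± [Π′], 16, 16) of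
`HodgeLocusCensusGrassmannianCells` HOLD: rank [p_{i+j}(δ)] = r over every field of characteristic 0 and every primitive 8th root of unity.
What is proved is exactly the typed first-order statement (the rank of Movasati's matrix); the census LABELS of these rows (EXPLAINED-SMOOTH /
NOT (α) / OPEN INSTANCE: the geometry of the Hodge locus beyond first order) are records of the cell, not Lean theorems, and are untouched.
-/

namespace Summit.HodgeConjecture.HodgeConjecture.HodgeLocus.Census.PlaneSum

open TwistCells GrSection

/-- the census class `scrollMinus4` on X⁴_4 is the plane list of `scrollL`. -/
theorem scroll_list4 : scrollMinus4 = planeList4 scrollL := by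
  simp [scrollMinus4, planeList4, scrollL]

/-- PROVED ROW: `TwistCells.explainedSmooth_4_4_scroll` — rank [p_{i+j}(δ)] = 12. -/
theorem explainedSmooth_4_4_scroll_holds : TwistCells.explainedSmooth_4_4_scroll := by
  unfold TwistCells.explainedSmooth_4_4_scroll ExplainedSmoothRow
  rw [scroll_list4]
  exact ivhsRankEq_of_cert4 scrollL scrollCert scroll_valid scrollModeK4 scrollOff4 scroll_H1_4 scroll_H2_4 scroll_H3_4

/-- the census class `zPlusPi4` on X⁴_4 is the plane list of `zPlusPiL`. -/
theorem zPlusPi_list4 : zPlusPi4 = planeList4 zPlusPiL := by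
  simp [zPlusPi4, planeList4, zPlusPiL]

/-- PROVED ROW: `TwistCells.firstOrder_4_4_zPlusPi` — rank [p_{i+j}(δ)] = 13. -/
theorem firstOrder_4_4_zPlusPi_holds : TwistCells.firstOrder_4_4_zPlusPi := by
  unfold TwistCells.firstOrder_4_4_zPlusPi
  rw [zPlusPi_list4]
  exact ivhsRankEq_of_cert4 zPlusPiL zPlusPiCert zPlusPi_valid zPlusPiModeK4 zPlusPiOff4 zPlusPi_H1_4 zPlusPi_H2_4 zPlusPi_H3_4

/-- the census class `twistMinus4` on X⁴_4 is the plane list of `twistMinusL`. -/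
theorem twistMinus_list4 : twistMinus4 = planeList4 twistMinusL := by
  simp [twistMinus4, planeList4, twistMinusL]

/-- PROVED ROW: `TwistCells.openInstance_4_4_twistMinus` — rank [p_{i+j}(δ)] = 11. -/
theorem openInstance_4_4_twistMinus_holds : TwistCells.openInstance_4_4_twistMinus := by
  unfold TwistCells.openInstance_4_4_twistMinus
  rw [twistMinus_list4]
  exact ivhsRankEq_of_cert4 twistMinusL twistMinusCert twistMinus_valid twistMinusModeK4 twistMinusOff4 twistMinus_H1_4 twistMinus_H2_4 twistMinus_H3_4

/-- the census class `twistPlus4` on X⁴_4 is the plane list of `twistPlusL`. -/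
theorem twistPlus_list4 : twistPlus4 = planeList4 twistPlusL := by
  simp [twistPlus4, planeList4, twistPlusL]

/-- PROVED ROW: `TwistCells.openInstance_4_4_twistPlus` — rank [p_{i+j}(δ)] = 11. -/
theorem openInstance_4_4_twistPlus_holds : TwistCells.openInstance_4_4_twistPlus := by
  unfold TwistCells.openInstance_4_4_twistPlus
  rw [twistPlus_list4]
  exact ivhsRankEq_of_cert4 twistPlusL twistPlusCert twistPlus_valid twistPlusModeK4 twistPlusOff4 twistPlus_H1_4 twistPlus_H2_4 twistPlus_H3_4

/-- the census class `explainedSmooth_4_4_ZplusPiPrime` on X⁴_4 is the plane list of `zPlusPiPrimeL`. -/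
theorem zPlusPiPrime_list4 : [(1, plane44 0 0 0), (1, plane44 0 2 0), (1, plane44 3 0 0), (1, plane44 3 2 0), (1, plane44 0 0 1)] = planeList4 zPlusPiPrimeL := by
  simp [planeList4, zPlusPiPrimeL]

/-- PROVED ROW: `GrSection.explainedSmooth_4_4_ZplusPiPrime` — rank [p_{i+j}(δ)] = 16. -/
theorem explainedSmooth_4_4_ZplusPiPrime_holds : GrSection.explainedSmooth_4_4_ZplusPiPrime := by
  unfold GrSection.explainedSmooth_4_4_ZplusPiPrime ExplainedSmoothRow
  rw [zPlusPiPrime_list4]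
  exact ivhsRankEq_of_cert4 zPlusPiPrimeL zPlusPiPrimeCert zPlusPiPrime_valid zPlusPiPrimeModeK4 zPlusPiPrimeOff4 zPlusPiPrime_H1_4 zPlusPiPrime_H2_4 zPlusPiPrime_H3_4

/-- the census class `notAlpha_4_4_ZminusPiPrime` on X⁴_4 is the plane list of `zMinusPiPrimeL`. -/
theorem zMinusPiPrime_list4 : [(1, plane44 0 0 0), (1, plane44 0 2 0), (1, plane44 3 0 0), (1, plane44 3 2 0), (-1, plane44 0 0 1)] = planeList4 zMinusPiPrimeL := by
  simp [planeList4, zMinusPiPrimeL]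

/-- PROVED ROW: `GrSection.notAlpha_4_4_ZminusPiPrime` — rank [p_{i+j}(δ)] = 16. -/
theorem notAlpha_4_4_ZminusPiPrime_holds : GrSection.notAlpha_4_4_ZminusPiPrime := by
  unfold GrSection.notAlpha_4_4_ZminusPiPrime
  rw [zMinusPiPrime_list4]
  exact ivhsRankEq_of_cert4 zMinusPiPrimeL zMinusPiPrimeCert zMinusPiPrime_valid zMinusPiPrimeModeK4 zMinusPiPrimeOff4 zMinusPiPrime_H1_4 zMinusPiPrime_H2_4 zMinusPiPrime_H3_4

end Summit.HodgeConjecture.HodgeConjecture.HodgeLocus.Census.PlaneSum
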